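import Literature.Geometry.Lorentzian.CurvatureRegularity
import Literature.Geometry.Lorentzian.IsometryProofs
import Literature.Geometry.Lorentzian.InitialData
import Literature.Geometry.Lorentzian.Hypersurface
import HarnessLib

/-!
# The Ricci tensor as a smooth section of the bundle of bilinear forms; the data `h + t Ric`

Step `ha` of the Ricci variation of Schoen–Yau (Comm. Math. Phys. 65 (1979), §3, p. 72:
*"We define a one-parameter family of metrics `ds²_t` on `N` by `ds²_t = ds² + t Ric` … These
metrics are defined in a neighborhood of `t = 0`"*; hypothesis `ha` of
`exists_ricciVariation_massFunction_of_massZero_of_analytic_steps`, `RicciVariationStepsProofs.lean`)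
needs the Ricci tensor as *data*: a smooth, symmetric field of continuous bilinear forms that can
be added to the metric of an `InitialDataSet`. This file provides (all proved):

* `bilinBasis`, `eq_sum_smul_bilinBasis`, `contMDiffAt_bilin_of_apply` — a field of continuous
  bilinear forms on a finite-dimensional space is `C^k` as soon as its values on a basis are;
* `PseudoRiemannianMetric.ricciCLM` — **the Ricci tensor as a continuous bilinear form** on each
  tangent space (`ricciCLM_apply : ricciCLM x v w = Ric_x(v, w)`, `ricciCLM_symm`);
* `PseudoRiemannianMetric.contMDiff_ricciCLM` — **`Ric` is a `C^∞` section of the bundle of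
  bilinear forms on `TM`** (O'Neill 1983, Ch. 3, Def. 3.51: `Ric ∈ 𝔗⁰₂(M)`): in the canonical
  trivialization its entries on the induced local frame are the smooth functions of
  `contMDiffOn_ricci_apply` (`CurvatureRegularity.lean`), and `contMDiffAt_bilin_iff`
  (`IsometryProofs.lean`);
* `InitialDataSet.addForm` — the data `(h + T, k)` for a smooth symmetric `T` with `h + T > 0`;
* `InitialDataSet.addRicci` — **the Ricci variation `(h + t Ric, k)`** under a bound
  `|Ric(v,v)| ≤ C h(v,v)` and `|t| C < 1` (`metric_addRicci_val : (h + t Ric)(v,w) = h(v,w) + t Ric(v,w)`).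

## References

* R. Schoen, S.-T. Yau, *On the proof of the positive mass conjecture in general relativity*,
  Comm. Math. Phys. 65 (1979) 45–76, §3, p. 72.
* B. O'Neill, *Semi-Riemannian geometry* (1983), Ch. 3, Def. 3.51, Lemma 3.52.
-/

noncomputable section

open Bundle Set Function Filter FiberBundle
open scoped Manifold ContDiff Topology

namespace Literature.Geometry.Lorentzian

/-! ### Continuous bilinear maps from their values on a basis -/

section BilinBasis

variable {E : Type*} [NormedAddCommGroup E] [NormedSpace ℝ E] [FiniteDimensional ℝ E]
  {ι : Type*}

/-- The continuous bilinear forms `(v, w) ↦ bⁱ(v) bʲ(w)` built from the coordinate functionals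
of a basis `b` of a finite-dimensional space (a basis of the space of bilinear forms). [folklore] -/
def bilinBasis (b : Module.Basis ι ℝ E) (i j : ι) : E →L[ℝ] E →L[ℝ] ℝ :=
  (ContinuousLinearMap.mul ℝ ℝ).bilinearComp (LinearMap.toContinuousLinearMap (b.coord i))
    (LinearMap.toContinuousLinearMap (b.coord j))

/-- `(bⁱ ⊗ bʲ)(v, w) = bⁱ(v) bʲ(w)`. [folklore] -/
@[simp]
theorem bilinBasis_apply (b : Module.Basis ι ℝ E) (i j : ι) (v w : E) :
    bilinBasis b i j v w = b.coord i v * b.coord j w := rfl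

variable [Fintype ι]

/-- **A continuous bilinear form is determined by its values on a basis**:
`β = ∑ᵢⱼ β(bᵢ, bⱼ) · (bⁱ ⊗ bʲ)`. [folklore] -/
theorem eq_sum_smul_bilinBasis (b : Module.Basis ι ℝ E) (β : E →L[ℝ] E →L[ℝ] ℝ) :
    β = ∑ i, ∑ j, β (b i) (b j) • bilinBasis b i j := by
  ext v w
  simp only [FunLike.coe_sum, Finset.sum_apply, FunLike.coe_smul, Pi.smul_apply,
    bilinBasis_apply, smul_eq_mul]
  conv_lhs => rw [← b.sum_repr v, ← b.sum_repr w]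
  simp only [map_sum, map_smul, FunLike.coe_sum, Finset.sum_apply, FunLike.coe_smul,
    Pi.smul_apply, smul_eq_mul, Finset.mul_sum]
  rw [Finset.sum_comm]
  refine Finset.sum_congr rfl fun i _ ↦ Finset.sum_congr rfl fun j _ ↦ ?_
  rw [Module.Basis.coord_apply, Module.Basis.coord_apply]
  ring

variable {EM : Type*} [NormedAddCommGroup EM] [NormedSpace ℝ EM] {HM : Type*}
  [TopologicalSpace HM] {I : ModelWithCorners ℝ EM HM} {M : Type*} [TopologicalSpace M]
  [ChartedSpace HM M] {k : ℕ∞ω}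

/-- **A family of continuous bilinear forms is `C^k` if all its values on a basis are `C^k`.**
[folklore] -/
theorem contMDiffAt_bilin_of_apply (b : Module.Basis ι ℝ E) {Φ : M → E →L[ℝ] E →L[ℝ] ℝ} {x₀ : M}
    (h : ∀ i j, CMDiffAt k (fun x ↦ Φ x (b i) (b j)) x₀) :
    CMDiffAt k Φ x₀ := by
  have hΦ : Φ = fun x ↦ ∑ i, ∑ j, Φ x (b i) (b j) • bilinBasis b i j :=
    funext fun x ↦ eq_sum_smul_bilinBasis b (Φ x)
  rw [hΦ]
  exact contMDiffAt_finsetSum fun i _ ↦ contMDiffAt_finsetSum fun j _ ↦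
    (h i j).smul contMDiffAt_const

end BilinBasis

/-! ### The Ricci tensor as a smooth field of continuous bilinear forms -/

section RicciCLM

variable {E : Type*} [NormedAddCommGroup E] [NormedSpace ℝ E] {H : Type*} [TopologicalSpace H]
  {I : ModelWithCorners ℝ E H} {M : Type*} [TopologicalSpace M] [ChartedSpace H M]
  [IsManifold I ∞ M] [FiniteDimensional ℝ E] [CompleteSpace E]
  (g : PseudoRiemannianMetric I ∞ E (TangentSpace I : M → Type _)) [g.HasLeviCivita]

namespace PseudoRiemannianMetric

/-- **The Ricci tensor as a continuous bilinear form** on each tangent space (the algebraic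
`g.ricci x`, O'Neill 1983, Ch. 3, Lemma 3.52, made continuous by finite dimension).
[cite: ONeill1983, Ch. 3, Lemma 3.52] -/
def ricciCLM (x : M) : TangentSpace I x →L[ℝ] TangentSpace I x →L[ℝ] ℝ :=
  haveI : FiniteDimensional ℝ (TangentSpace I x) := ‹FiniteDimensional ℝ E›
  haveI : T2Space (TangentSpace I x) := inferInstanceAs (T2Space E)
  LinearMap.toContinuousLinearMap
    ((LinearMap.toContinuousLinearMap :
        (TangentSpace I x →ₗ[ℝ] ℝ) ≃ₗ[ℝ] (TangentSpace I x →L[ℝ] ℝ)).toLinearMap ∘ₗ g.ricci x)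

omit [CompleteSpace E] in
/-- `ricciCLM` is the Ricci tensor: `Ric_x(v, w)`. [folklore] -/
@[simp]
theorem ricciCLM_apply (x : M) (v w : TangentSpace I x) : g.ricciCLM x v w = g.ricci x v w := rfl

/-- The Ricci form is symmetric (`ricci_symm_holds`). O'Neill 1983, Ch. 3, Lemma 3.52.
[cite: ONeill1983, Ch. 3, Lemma 3.52] -/
theorem ricciCLM_symm (x : M) (v w : TangentSpace I x) :
    g.ricciCLM x v w = g.ricciCLM x w v := by
  rw [ricciCLM_apply, ricciCLM_apply]
  exact (ricci_symm_holds (g := g) (WithTop.coe_le_coe.mpr le_top) x).eq v w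

/-- **The Ricci tensor is a smooth section of the bundle of bilinear forms** (O'Neill 1983,
Ch. 3, Def. 3.51: `Ric ∈ 𝔗⁰₂(M)`): in the canonical trivialization at `x₀` its coordinate
expression `x ↦ ((v, w) ↦ Ric_x(τ_x⁻¹ v, τ_x⁻¹ w))` has `C^∞` entries on a basis of `E`
(`contMDiffOn_ricci_apply` on the frame fields `x ↦ τ_x⁻¹ bᵢ`, which are the local frame of `τ`),
hence is `C^∞` (`contMDiffAt_bilin_of_apply`, `contMDiffAt_bilin_iff`).
[cite: ONeill1983, Ch. 3, Def. 3.51] -/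
theorem contMDiff_ricciCLM :
    ContMDiff I (I.prod 𝓘(ℝ, E →L[ℝ] E →L[ℝ] ℝ)) ∞
      (fun x ↦ TotalSpace.mk' (E →L[ℝ] E →L[ℝ] ℝ)
        (E := fun x : M ↦ TangentSpace I x →L[ℝ] TangentSpace I x →L[ℝ] ℝ) x (g.ricciCLM x)) := by
  classical
  intro x₀
  rw [contMDiffAt_bilin_iff]
  refine ⟨contMDiffAt_id, ?_⟩
  set τ := trivializationAt E (TangentSpace I : M → Type _) x₀ with hτ
  set bE := Module.finBasis ℝ E with hbE
  have hx₀ : x₀ ∈ τ.baseSet := mem_baseSet_trivializationAt E (TangentSpace I : M → Type _) x₀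
  refine contMDiffAt_bilin_of_apply bE fun i j ↦ ?_
  -- the frame fields `x ↦ τ_x⁻¹ bᵢ` are the local frame of `τ`, smooth on its base set
  have hY : ∀ i, CMDiff[τ.baseSet] ∞ (T% (fun x : M ↦ (τ.symmL ℝ x (bE i) : TangentSpace I x))) :=
    fun i ↦ (τ.contMDiffOn_localFrame_baseSet ∞ bE i).congr fun x hx ↦ by
      simp only [τ.localFrame_apply_of_mem_baseSet bE hx, Trivialization.basisAt,
        Module.Basis.map_apply, Trivialization.linearEquivAt_symm_apply,
        Trivialization.symmL_apply _ hx]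
  have hLC := isLeviCivita_leviCivita_holds (g := g)
  have h := contMDiffOn_ricci_apply τ (hLC.isLocallyContMDiff_one (WithTop.coe_le_coe.mpr le_top))
    (hLC.isLocallyContMDiff ⊤ (le_of_eq rfl)) (hY i) (hY j)
  have h' : CMDiffAt ∞ (fun x ↦ g.leviCivita.ricci x (τ.symmL ℝ x (bE i)) (τ.symmL ℝ x (bE j))) x₀ :=
    (h x₀ hx₀).contMDiffAt (τ.open_baseSet.mem_nhds hx₀)
  exact h'

end PseudoRiemannianMetric

end RicciCLM

/-! ### The data `(h + T, k)` and the Ricci variation `ds² + t Ric` -/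

section AddForm

variable {E : Type*} [NormedAddCommGroup E] [NormedSpace ℝ E] [FiniteDimensional ℝ E]
  {H : Type*} [TopologicalSpace H] {I : ModelWithCorners ℝ E H}
  {X : Type*} [TopologicalSpace X] [ChartedSpace H X] [IsManifold I ∞ X]

namespace InitialDataSet

/-- **The data `(h + T, k)`.** For an initial data set `D = (h, k)` and a smooth symmetric field
`T` of continuous bilinear forms on `TX` with `h + T` positive definite, the data with metric
`x ↦ h_x + T_x` (symmetric, positive definite, with von Neumann bounded unit balls by finite
dimension, smooth as a sum of smooth sections) and the same `k`. With `T = t Ric` this is the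
family `ds²_t = ds² + t Ric` of Schoen–Yau, Comm. Math. Phys. 65 (1979), p. 72.
[cite: SchoenYauPMT1979, §3 p. 72] -/
def addForm (D : InitialDataSet I X)
    (T : Π x : X, TangentSpace I x →L[ℝ] TangentSpace I x →L[ℝ] ℝ)
    (hT : ContMDiff I (I.prod 𝓘(ℝ, E →L[ℝ] E →L[ℝ] ℝ)) ∞
      (fun x ↦ TotalSpace.mk' (E →L[ℝ] E →L[ℝ] ℝ)
        (E := fun x : X ↦ TangentSpace I x →L[ℝ] TangentSpace I x →L[ℝ] ℝ) x (T x)))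
    (hsymm : ∀ (x : X) (v w : TangentSpace I x), T x v w = T x w v)
    (hpos : ∀ (x : X) (v : TangentSpace I x), v ≠ 0 → 0 < D.h.inner x v v + T x v v) :
    InitialDataSet I X where
  h :=
    { inner := fun x ↦ D.h.inner x + T x
      symm := fun x v w ↦ by
        change D.h.inner x v w + T x v w = D.h.inner x w v + T x w v
        rw [D.h.symm x v w, hsymm x v w]
      pos := fun x v hv ↦ by
        change 0 < D.h.inner x v v + T x v v
        exact hpos x v hv
      isVonNBounded := fun x ↦ by
        refine PseudoRiemannianMetric.IsSpacelikeImmersion.isVonNBounded_setOf_lt_one_of_pos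
          (V := E) (D.h.inner x + T x) fun v hv ↦ ?_
        change 0 < D.h.inner x v v + T x v v
        exact hpos x v hv
      contMDiff := D.h.contMDiff.add_section hT }
  k := D.k
  k_symm := D.k_symm
  contMDiff_k := D.contMDiff_k

/-- The metric of `(h + T, k)` at `x` is `h_x + T_x`. [folklore] -/
@[simp]
lemma addForm_h_inner (D : InitialDataSet I X)
    (T : Π x : X, TangentSpace I x →L[ℝ] TangentSpace I x →L[ℝ] ℝ) (hT) (hsymm) (hpos) (x : X) :
    (D.addForm T hT hsymm hpos).h.inner x = D.h.inner x + T x := rfl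

/-- The metric of `(h + T, k)` on vectors: `(h + T)_x(v, w) = h_x(v, w) + T_x(v, w)`. [folklore] -/
@[simp]
lemma metric_addForm_val (D : InitialDataSet I X)
    (T : Π x : X, TangentSpace I x →L[ℝ] TangentSpace I x →L[ℝ] ℝ) (hT) (hsymm) (hpos) (x : X)
    (v w : TangentSpace I x) :
    (D.addForm T hT hsymm hpos).metric.val x v w = D.metric.val x v w + T x v w := rfl

/-- The tensor `k` of `(h + T, k)` is that of `D`. [folklore] -/
@[simp]
lemma addForm_k (D : InitialDataSet I X)
    (T : Π x : X, TangentSpace I x →L[ℝ] TangentSpace I x →L[ℝ] ℝ) (hT) (hsymm) (hpos) (x : X) :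
    (D.addForm T hT hsymm hpos).k x = D.k x := rfl

variable [CompleteSpace E]

/-- **The Ricci variation `ds²_t = ds² + t Ric`** (Schoen–Yau, Comm. Math. Phys. 65 (1979),
p. 72: "We define a one-parameter family of metrics `ds²_t` on `N` by `ds²_t = ds² + t Ric` …
These metrics are defined in a neighborhood of `t = 0`"): given a bound `|Ric(v,v)| ≤ C h(v,v)`
and `|t| C < 1`, the data `(h + t Ric, k)` (`h + t Ric ≥ (1 - |t| C) h` is positive definite).
[cite: SchoenYauPMT1979, §3 p. 72] -/
def addRicci (D : InitialDataSet I X) [D.metric.HasLeviCivita] {C : ℝ}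
    (hC : ∀ (x : X) (v : TangentSpace I x), |D.metric.ricci x v v| ≤ C * D.metric.val x v v)
    (t : ℝ) (ht : |t| * C < 1) : InitialDataSet I X :=
  D.addForm (fun x ↦ t • D.metric.ricciCLM x) (D.metric.contMDiff_ricciCLM.const_smul_section)
    (fun x v w ↦ by
      change t * D.metric.ricciCLM x v w = t * D.metric.ricciCLM x w v
      rw [D.metric.ricciCLM_symm x v w])
    (fun x v hv ↦ by
      change 0 < D.h.inner x v v + t * D.metric.ricci x v v
      have hvv : 0 < D.metric.val x v v := D.isRiemannian_metric x v hv
      have h1 := hC x v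
      have h2 : -(|t| * (C * D.metric.val x v v)) ≤ t * D.metric.ricci x v v := by
        have h3 := neg_abs_le (t * D.metric.ricci x v v)
        rw [abs_mul] at h3
        nlinarith [abs_nonneg t]
      have h4 : 0 < (1 - |t| * C) * D.metric.val x v v := mul_pos (by linarith) hvv
      change 0 < D.metric.val x v v + t * D.metric.ricci x v v
      nlinarith)

/-- The metric of the Ricci variation on vectors: `(ds²_t)_x(v, w) = h_x(v, w) + t Ric_x(v, w)`.
Schoen–Yau 1979, p. 72. [cite: SchoenYauPMT1979, §3 p. 72] -/
@[simp]
lemma metric_addRicci_val (D : InitialDataSet I X) [D.metric.HasLeviCivita] {C : ℝ}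
    (hC : ∀ (x : X) (v : TangentSpace I x), |D.metric.ricci x v v| ≤ C * D.metric.val x v v)
    (t : ℝ) (ht : |t| * C < 1) (x : X) (v w : TangentSpace I x) :
    (D.addRicci hC t ht).metric.val x v w = D.metric.val x v w + t * D.metric.ricci x v w := rfl

/-- The tensor `k` of the Ricci variation is that of `D`. [folklore] -/
@[simp]
lemma addRicci_k (D : InitialDataSet I X) [D.metric.HasLeviCivita] {C : ℝ}
    (hC : ∀ (x : X) (v : TangentSpace I x), |D.metric.ricci x v v| ≤ C * D.metric.val x v v)
    (t : ℝ) (ht : |t| * C < 1) (x : X) : (D.addRicci hC t ht).k x = D.k x := rfl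

end InitialDataSet

end AddForm

end Literature.Geometry.Lorentzian

end
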